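import Summits.Ventures.PercRepro.GenQClassElevenSixteenC

/-!
# PercRepro — the corank-`12` split, part D: two `17`-traces leave no `16`- and no `15`-trace; three leave no `14`-trace
(night-4, gen 14)

At corank `12` (`n = 19`) the type-`6` two-level LP on tree rows is negative on the classes `h₁₇ = 2, h₁₆ ∈ {0, 1}` and
`h₁₇ = 3, h₁₆ ∈ {0, 1}` (sheet §66 (h)); with the forced facts of this file it is `+78,430.95` at
`(h₁₇, h₁₆, h₁₅) = (2, 0, 0)` and `+191,412.90` at `(3, 0, 0, h₁₄ = 0)` (kit j270381).  Two distinct `17`-traces `K, K′`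
meet in a rank-`5` flat `F` with `f ∈ {15, 16}` points of `G`; every `16`-trace `L` contains `F`
(`16 + f − 19 ≥ 12 > 10`): for `f = 16` its trace is `F ∩ G`, not spanning, for `f = 15` its point outside `F` is one
of the two outside points of `K` or of `K′` (they fill `G ∖ F`), so `L = K` or `K′` — impossible by the sizes
(**`hypTr_sixteen_eq_zero_of_two_le_seventeen`**); every `15`-trace contains `F` and has `≥ f ≥ 15` points, so its trace
is `F ∩ G` — not spanning (**`hypTr_fifteen_eq_zero_of_two_le_seventeen`**).  With a third `17`-trace `f = 15` is
impossible (its two outside points would meet those of `K` or `K′`), so `f = 16` and a `14`-trace would contain `F`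
(`14 + 16 − 19 = 11`) with `≥ 16` points (**`hypTr_fourteen_eq_zero_of_three_le_seventeen`**).
Imports `GenQClassElevenSixteenC` (parts A–C).
-/
namespace PercRepro.Night4

open Finset ThmH SixFour GenQ PerFlat Star

variable {α : Type*} [DecidableEq α] {M : Matroid α} [M.Finite]

/-- The trace of a flat through a rank-`5` flat `F` with `≥ 11` common points contains `F ∩ G`; generic counting
helper: a flat `H` with an `s`-point trace and a rank-`5` flat `F` with `f` points of `G`, `11 + n ≤ s + f`. -/
theorem subset_of_card_add_card (hB : ∀ a ≤ 7 - 3, ∀ K ∈ flatsQ M a, K.card ≤ 10) {G F H : Finset α}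
    {r s : ℕ} (hF : F ∈ flatsQ M 5) (hH : H ∈ flatsTr M G r s) (h11 : 11 + G.card ≤ s + (F ∩ G).card) :
    F ⊆ H := by
  have hH' := mem_flatsTr.1 hH
  refine subset_of_eleven_le_card_inter hB hF (mem_flatsQ.1 hH'.1).2.1 ?_
  have hsub : (F ∩ G) ∩ (H ∩ G) ⊆ F ∩ H := by
    intro x hx
    rw [Finset.mem_inter] at hx ⊢
    exact ⟨(Finset.mem_inter.1 hx.1).1, (Finset.mem_inter.1 hx.2).1⟩
  have hU : (F ∩ G) ∪ (H ∩ G) ⊆ G := by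
    intro x hx
    simp only [Finset.mem_union, Finset.mem_inter] at hx
    rcases hx with hx | hx
    · exact hx.2
    · exact hx.2
  have h1 := Finset.card_union_add_card_inter (F ∩ G) (H ∩ G)
  have h2 := Finset.card_le_card hU
  have h3 := Finset.card_le_card hsub
  rw [hH'.2.1] at h1
  omega

/-- A spanning trace is not inside a rank-`5` flat. -/
theorem not_subset_of_mem_flatsTr_six {G F H : Finset α} {s : ℕ} (hF : F ∈ flatsQ M 5) (hH : H ∈ flatsTr M G 6 s) :
    ¬ H ∩ G ⊆ F := by
  intro hsub
  have hH' := mem_flatsTr.1 hH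
  have hle : M.eRk ((H ∩ G : Finset α) : Set α) ≤ M.eRk (F : Set α) := M.eRk_mono (Finset.coe_subset.2 hsub)
  rw [hH'.2.2, (mem_flatsQ.1 hF).2.2] at hle
  have : (6 : ℕ) ≤ 5 := by exact_mod_cast hle
  omega

/-- Two distinct `s`-traces at `n` points with `2s − n > 10` meet in a rank-`5` flat with `2s − n ≤ f ≤ s − 1`
points of `G`. -/
theorem exists_card_inter_of_two_traces (hB : ∀ a ≤ 7 - 3, ∀ K ∈ flatsQ M a, K.card ≤ 10) {G K K' : Finset α}
    {s : ℕ} (hK : K ∈ flatsTr M G 6 s) (hK' : K' ∈ flatsTr M G 6 s) (hne : K ≠ K') (hlarge : 10 < 2 * s - G.card) :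
    K ∩ K' ∈ flatsQ M 5 ∧ 2 * s - G.card ≤ ((K ∩ K') ∩ G).card ∧ ((K ∩ K') ∩ G).card + 1 ≤ s := by
  refine ⟨inter_mem_flatsQ_of_large_traces (q := 7) (s := s) (B := 10) (by norm_num) hB hK hK' hne hlarge,
    two_mul_sub_le_card_inter_of_mem_flatsTr hK hK', ?_⟩
  by_contra hlt
  rw [not_le] at hlt
  have hK1 := mem_flatsTr.1 hK
  have hK1' := mem_flatsTr.1 hK'
  have hsub : (K ∩ K') ∩ G ⊆ K ∩ G := by
    intro x hx
    rw [Finset.mem_inter] at hx ⊢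
    exact ⟨(Finset.mem_inter.1 hx.1).1, hx.2⟩
  have hsub' : (K ∩ K') ∩ G ⊆ K' ∩ G := by
    intro x hx
    rw [Finset.mem_inter] at hx ⊢
    exact ⟨(Finset.mem_inter.1 hx.1).2, hx.2⟩
  have heq : (K ∩ K') ∩ G = K ∩ G := Finset.eq_of_subset_of_card_le hsub (by omega)
  have heq' : (K ∩ K') ∩ G = K' ∩ G := Finset.eq_of_subset_of_card_le hsub' (by omega)
  exact hne (eq_of_inter_eq_of_mem_flatsTr hK hK' (heq.symm.trans heq'))

/-- The points of `G` outside `F = K ∩ K′` are the outside points of `K` and those of `K′` when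
`2(s − f) = n − f`: a point of `G ∖ F` lies in `K` or in `K′`. -/
theorem mem_or_mem_of_outside {G K K' : Finset α} {s : ℕ} (hK : K ∈ flatsTr M G 6 s) (hK' : K' ∈ flatsTr M G 6 s)
    (hfill : 2 * (s - ((K ∩ K') ∩ G).card) = G.card - ((K ∩ K') ∩ G).card) {x : α} (hxG : x ∈ G) (hxF : x ∉ K ∩ K') : x ∈ K ∨ x ∈ K' := by
  by_contra hnot
  rw [not_or] at hnot
  have hK1 := mem_flatsTr.1 hK
  have hK1' := mem_flatsTr.1 hK'
  have hdisj : Disjoint ((K ∩ G) \ (K ∩ K')) ((K' ∩ G) \ (K ∩ K')) := by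
    rw [Finset.disjoint_left]
    intro z hz hz'
    rw [Finset.mem_sdiff, Finset.mem_inter] at hz hz'
    exact hz.2 (Finset.mem_inter.2 ⟨hz.1.1, hz'.1.1⟩)
  have hcK : ((K ∩ G) \ (K ∩ K')).card = s - ((K ∩ K') ∩ G).card := by
    have hEq : (K ∩ K') ∩ (K ∩ G) = (K ∩ K') ∩ G := by
      ext z
      simp only [Finset.mem_inter]
      tauto
    rw [Finset.card_sdiff, hK1.2.1, hEq]
  have hcK' : ((K' ∩ G) \ (K ∩ K')).card = s - ((K ∩ K') ∩ G).card := by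
    have hEq : (K ∩ K') ∩ (K' ∩ G) = (K ∩ K') ∩ G := by
      ext z
      simp only [Finset.mem_inter]
      tauto
    rw [Finset.card_sdiff, hK1'.2.1, hEq]
  have hsub : insert x (((K ∩ G) \ (K ∩ K')) ∪ ((K' ∩ G) \ (K ∩ K'))) ⊆ G \ (K ∩ K') := by
    intro z hz
    simp only [Finset.mem_insert, Finset.mem_union, Finset.mem_sdiff, Finset.mem_inter] at hz
    rw [Finset.mem_sdiff]
    rcases hz with hz | hz | hz
    · rw [hz]; exact ⟨hxG, hxF⟩
    · exact ⟨hz.1.2, fun h => hz.2 (Finset.mem_inter.1 h)⟩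
    · exact ⟨hz.1.2, fun h => hz.2 (Finset.mem_inter.1 h)⟩
  have hxnot : x ∉ ((K ∩ G) \ (K ∩ K')) ∪ ((K' ∩ G) \ (K ∩ K')) := by
    simp only [Finset.mem_union, Finset.mem_sdiff, Finset.mem_inter]
    rintro (h | h)
    · exact hnot.1 h.1.1
    · exact hnot.2 h.1.1
  have hcard' := Finset.card_le_card hsub
  rw [Finset.card_insert_of_notMem hxnot, Finset.card_union_of_disjoint hdisj, hcK, hcK', Finset.card_sdiff] at hcard'
  omega

/-- **Two `17`-traces leave no `16`-trace** (`n = 19`, the core). -/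
theorem hypTr_sixteen_eq_zero_of_two_le_seventeen (hs : Simple M) (hline : ∀ L ∈ flatsQ M 2, L.card ≤ 3)
    (hplane : ∀ P ∈ flatsQ M 3, P.card ≤ 6) (hsolid : ∀ F ∈ flatsQ M 4, F.card ≤ 10) {G : Finset α}
    (hG : G ⊆ gr M) (hcard : G.card = 19) (h17 : 2 ≤ hypTr M G 6 17) : hypTr M G 6 16 = 0 := by
  have hB := flats_le_four_card_le_ten hs hline hplane hsolid
  unfold hypTr at h17 ⊢
  obtain ⟨K, K', hK, hK', hne⟩ := Finset.one_lt_card_iff.1 (by omega : 1 < (flatsTr M G 6 17).card)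
  obtain ⟨hF, hf15, hf16⟩ := exists_card_inter_of_two_traces hB hK hK' hne (by omega)
  have hK1 := mem_flatsTr.1 hK
  have hK1' := mem_flatsTr.1 hK'
  rw [Finset.card_eq_zero, Finset.eq_empty_iff_forall_notMem]
  intro L hL
  have hL1 := mem_flatsTr.1 hL
  have hFL : K ∩ K' ⊆ L := subset_of_card_add_card hB hF hL (by omega)
  have hFGL : (K ∩ K') ∩ G ⊆ L ∩ G := by
    intro x hx
    rw [Finset.mem_inter] at hx ⊢
    exact ⟨hFL hx.1, hx.2⟩
  obtain ⟨x, hxL, hxF⟩ := Finset.not_subset.1 (not_subset_of_mem_flatsTr_six hF hL)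
  rw [Finset.mem_inter] at hxL
  -- `f = 16` would make the trace of `L` equal to `F ∩ G`
  have hf : ((K ∩ K') ∩ G).card = 15 := by
    by_contra hne16
    have heq : (K ∩ K') ∩ G = L ∩ G := Finset.eq_of_subset_of_card_le hFGL (by omega)
    have : x ∈ (K ∩ K') ∩ G := by rw [heq]; exact Finset.mem_inter.2 hxL
    exact hxF (Finset.mem_inter.1 this).1
  have hxE : x ∈ M.E := by
    rw [← coe_gr M]
    exact Finset.mem_coe.2 (hG hxL.2)
  rcases mem_or_mem_of_outside hK hK' (by omega) hxL.2 hxF with hxK | hxK'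
  · exact ne_of_mem_flatsTr_of_card_ne hL hK (by norm_num)
      (eq_of_mem_of_subset_flatsQ_six hF hL1.1 hK1.1 hFL Finset.inter_subset_left hxE hxF hxL.1 hxK)
  · exact ne_of_mem_flatsTr_of_card_ne hL hK' (by norm_num)
      (eq_of_mem_of_subset_flatsQ_six hF hL1.1 hK1'.1 hFL Finset.inter_subset_right hxE hxF hxL.1 hxK')

/-- **Two `17`-traces leave no `15`-trace** (`n = 19`, the core). -/
theorem hypTr_fifteen_eq_zero_of_two_le_seventeen (hs : Simple M) (hline : ∀ L ∈ flatsQ M 2, L.card ≤ 3)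
    (hplane : ∀ P ∈ flatsQ M 3, P.card ≤ 6) (hsolid : ∀ F ∈ flatsQ M 4, F.card ≤ 10) {G : Finset α}
    (hcard : G.card = 19) (h17 : 2 ≤ hypTr M G 6 17) : hypTr M G 6 15 = 0 := by
  have hB := flats_le_four_card_le_ten hs hline hplane hsolid
  unfold hypTr at h17 ⊢
  obtain ⟨K, K', hK, hK', hne⟩ := Finset.one_lt_card_iff.1 (by omega : 1 < (flatsTr M G 6 17).card)
  obtain ⟨hF, hf15, hf16⟩ := exists_card_inter_of_two_traces hB hK hK' hne (by omega)
  rw [Finset.card_eq_zero, Finset.eq_empty_iff_forall_notMem]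
  intro H hH
  have hH1 := mem_flatsTr.1 hH
  have hFH : K ∩ K' ⊆ H := subset_of_card_add_card hB hF hH (by omega)
  have hFGH : (K ∩ K') ∩ G ⊆ H ∩ G := by
    intro x hx
    rw [Finset.mem_inter] at hx ⊢
    exact ⟨hFH hx.1, hx.2⟩
  have hle := Finset.card_le_card hFGH
  have heq : (K ∩ K') ∩ G = H ∩ G := Finset.eq_of_subset_of_card_le hFGH (by omega)
  exact not_subset_of_mem_flatsTr_six hF hH (by rw [← heq]; exact Finset.inter_subset_left)

/-- **Three `17`-traces leave no `14`-trace** (`n = 19`, the core): the common rank-`5` flat has `16` points. -/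
theorem hypTr_fourteen_eq_zero_of_three_le_seventeen (hs : Simple M) (hline : ∀ L ∈ flatsQ M 2, L.card ≤ 3)
    (hplane : ∀ P ∈ flatsQ M 3, P.card ≤ 6) (hsolid : ∀ F ∈ flatsQ M 4, F.card ≤ 10) {G : Finset α}
    (hG : G ⊆ gr M) (hcard : G.card = 19) (h17 : 3 ≤ hypTr M G 6 17) : hypTr M G 6 14 = 0 := by
  have hB := flats_le_four_card_le_ten hs hline hplane hsolid
  unfold hypTr at h17 ⊢
  obtain ⟨K, K', K'', hK, hK', hK'', hne, hne', hne''⟩ :=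
    Finset.two_lt_card_iff.1 (by omega : 2 < (flatsTr M G 6 17).card)
  obtain ⟨hF, hf15, hf16⟩ := exists_card_inter_of_two_traces hB hK hK' hne (by omega)
  have hK1 := mem_flatsTr.1 hK
  have hK1' := mem_flatsTr.1 hK'
  have hK1'' := mem_flatsTr.1 hK''
  -- `f = 16`: with `f = 15` the third trace `K″ ⊇ F` has an outside point in `K` or `K′`
  have hf : ((K ∩ K') ∩ G).card = 16 := by
    by_contra hne16
    have hf15' : ((K ∩ K') ∩ G).card = 15 := by omega
    have hFK'' : K ∩ K' ⊆ K'' := subset_of_card_add_card hB hF hK'' (by omega)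
    obtain ⟨x, hxK'', hxF⟩ := Finset.not_subset.1 (not_subset_of_mem_flatsTr_six hF hK'')
    rw [Finset.mem_inter] at hxK''
    have hxE : x ∈ M.E := by
      rw [← coe_gr M]
      exact Finset.mem_coe.2 (hG hxK''.2)
    rcases mem_or_mem_of_outside hK hK' (by omega) hxK''.2 hxF with hxK | hxK'
    · exact hne' (eq_of_mem_of_subset_flatsQ_six hF hK1.1 hK1''.1 Finset.inter_subset_left hFK'' hxE hxF hxK
        hxK''.1)
    · exact hne'' (eq_of_mem_of_subset_flatsQ_six hF hK1'.1 hK1''.1 Finset.inter_subset_right hFK'' hxE hxF hxK'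
        hxK''.1)
  rw [Finset.card_eq_zero, Finset.eq_empty_iff_forall_notMem]
  intro H hH
  have hH1 := mem_flatsTr.1 hH
  have hFH : K ∩ K' ⊆ H := subset_of_card_add_card hB hF hH (by omega)
  have hFGH : (K ∩ K') ∩ G ⊆ H ∩ G := by
    intro x hx
    rw [Finset.mem_inter] at hx ⊢
    exact ⟨hFH hx.1, hx.2⟩
  have hle := Finset.card_le_card hFGH
  omega

end PercRepro.Night4
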